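import Summits.AtomisticToContinuum.HydrodynamicLimit.Theorems.AnnealedZeroHorizonMeanFluxClosureCollisionalStressClosureB
import HarnessLib

/-!
# Stub CS `stub_collisionalStressClosure` of crux `MeanFluxClosure`
# (stmt-AtomisticToContinuum-9256, route AnnealedZeroHorizon, line `registered`): EOS-free part C,
# the isotropic/deviatoric split of the collisional stress and its domination by the scalar virial

Parts A/B (`…CollisionalStressClosure`, `…CollisionalStressClosureB`) replace the stub's collisional
momentum transfer `c W_φ` by the collision-indexed stress `c · collisionalStress (Dφ)` at cost `O(σ_N)`.
This file takes the next EOS-free step of the virial route (Spohn 1991, Part I (3.15)): at a collision the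
impulse is ALONG the line of centres, `Δvᵢ = λ n` (`n = xᵢ ⊖ xⱼ`, `λ = ⟪n, Δvᵢ⟫/‖n‖² > 0`), so every
collisional-stress term is a quadratic form in the contact direction,
`⟪A(x) n, Δvᵢ⟫ = λ ⟪A(x) n, n⟫` (`inner_apply_sepVec_vel_sub_leftLim`). Consequences:

* `abs_collisionalStress_le_mul_collisionalVirial_one` — **domination by the scalar virial**: for a
  bounded matrix field, `|collisionalStress A (a, b]| ≤ sup‖A‖ · collisionalVirial 1 (a, b]`
  (`collisionalVirial 1 = Σ_coll ⟪n, Δvᵢ⟫ ≥ 0`, `3 ×` volume `×` time-integrated collisional pressure), and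
  `collisionalVirial_one_le` — `collisionalVirial 1 (a, b] ≤ ε · ½ 𝒮(a, b] ≤ ε · ½ RS(a, b]`.
* `collisionalStress_eq_collisionalVirial_add` — **isotropic/deviatoric split** (linearity of the stress
  kernel in the matrix field): for any scalar field `ψ`,
  `collisionalStress A = collisionalVirial ψ + collisionalStress (A − ψ • 𝟙)`; with `A = Dφ`,
  `ψ = div φ / d` the second field is traceless (`trace_fderiv_sub_smul_id`), so the mean closure of
  `c · collisionalStress (Dφ)` splits into the PRESSURE part `c · collisionalVirial (div φ / 3)` (virial
  theorem + equation of state) and a DEVIATORIC collisional stress that should vanish in mean (isotropy of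
  contact directions at local equilibrium; EOS-free) — the collisional twin of the kinetic split KS-a/KS-b.
* `integrable_collisionalStress_flow_of_integrable_relSpeed` — conditional integrability of
  `collisionalStress A ∘ Φ_{t₁}` under any law `≪` Liouville given integrability of `RS ∘ Φ_{t₁}`.
* `stub_collisionalStressVirialSplit` — the registered sub-goal of stmt-AtomisticToContinuum-9256 packaging
  the split and the two dominations for a smooth `φ` and the stub's objects.

References: H. Spohn, *Large Scale Dynamics of Interacting Particles* (1991), Part I §3.2 (3.7), (3.15);
R. Soto, *Kinetic Theory and Transport Phenomena* (2016) §4.8.1 (4.91)–(4.93).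
-/

noncomputable section

namespace Summit.AtomisticToContinuum.HydrodynamicLimit.Theorems

open scoped BigOperators ENNReal Topology InnerProductSpace
open MeasureTheory Set Filter Function
open Literature.MathematicalPhysics.KineticTheory Literature.Analysis.FluidPDE Literature.Analysis.FunctionSpaces

namespace CollisionalStressClosure

/-! ## At a collision: the stress is a quadratic form in the contact direction -/

section Collision

variable {d : Type*} [Fintype d] {N : ℕ} {ε : ℝ} {γ : ℝ → Config N d (UnitAddTorus d)}

/-- **The impulse is along the line of centres**: at a collision of `{i, j}` with separation `n`,
for every continuous linear `T`, `⟪T n, Δvᵢ⟫ = (⟪n, Δvᵢ⟫ / ‖n‖²) ⟪T n, n⟫`. [folklore] -/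
theorem inner_apply_sepVec_vel_sub_leftLim (h : IsHardSphereTrajectory (Torus.geometry d) ε N γ)
    {t : ℝ} {i j : Fin N} (hij : i ≠ j) (hc : γ t ∈ contactSet (Torus.geometry d) N ε i j)
    (T : EuclideanSpace ℝ d →L[ℝ] EuclideanSpace ℝ d) :
    ⟪T ((Torus.geometry d).sepVec (γ t i).1 (γ t j).1), (γ t i).2 - (leftLim γ t i).2⟫_ℝ =
      ⟪(Torus.geometry d).sepVec (γ t i).1 (γ t j).1, (γ t i).2 - (leftLim γ t i).2⟫_ℝ /
          ‖(Torus.geometry d).sepVec (γ t i).1 (γ t j).1‖ ^ 2 *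
        ⟪T ((Torus.geometry d).sepVec (γ t i).1 (γ t j).1),
          (Torus.geometry d).sepVec (γ t i).1 (γ t j).1⟫_ℝ := by
  rw [h.vel_sub_leftLim_eq_smul Torus.continuous_geometry_translate hij hc]
  set n := (Torus.geometry d).sepVec (γ t i).1 (γ t j).1
  set c := -(⟪(leftLim γ t i).2 - (leftLim γ t j).2, n⟫_ℝ / ‖n‖ ^ 2)
  by_cases hn : n = 0
  · simp [hn]
  · have hnn : ‖n‖ ^ 2 ≠ 0 := pow_ne_zero 2 (norm_ne_zero_iff.2 hn)
    rw [real_inner_smul_right, real_inner_smul_right, real_inner_self_eq_norm_sq, mul_div_assoc,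
      div_self hnn, mul_one]

/-- **Per-collision domination of the stress by the virial**: at a collision of `{i, j}` (`ε < 1/2`),
for `‖A x‖ ≤ C`, `|Σ_{(i,j)} stressKernel A| ≤ C · Σ_{(i,j)} virialKernel 1 = C ⟪n, Δvᵢ⟫`. [folklore] -/
theorem abs_sum_collidingPairs_stressKernel_le (hε : ε < 2⁻¹)
    (h : IsHardSphereTrajectory (Torus.geometry d) ε N γ) {t : ℝ} {i j : Fin N} (hij : i ≠ j)
    (hc : γ t ∈ contactSet (Torus.geometry d) N ε i j)
    {A : UnitAddTorus d → EuclideanSpace ℝ d →L[ℝ] EuclideanSpace ℝ d} {C : ℝ} (hC : ∀ x, ‖A x‖ ≤ C) :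
    |∑ p ∈ collidingPairs (Torus.geometry d) ε (γ t),
        stressKernel (Torus.geometry d) A p.1 p.2 (leftLim γ t) (γ t)| ≤
      C * ∑ p ∈ collidingPairs (Torus.geometry d) ε (γ t),
        virialKernel (Torus.geometry d) (fun _ => (1 : ℝ)) p.1 p.2 (leftLim γ t) (γ t) := by
  have hreg := Torus.isHardSphereRegular_geometry (d := d) hε
  rw [h.sum_collidingPairs_stressKernel hreg hij hc, h.sum_collidingPairs_virialKernel hreg hij hc,
    inner_apply_sepVec_vel_sub_leftLim h hij hc]
  set n := (Torus.geometry d).sepVec (γ t i).1 (γ t j).1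
  set q := ⟪n, (γ t i).2 - (leftLim γ t i).2⟫_ℝ with hq_def
  have hq : 0 ≤ q := (h.inner_sepVec_vel_sub_leftLim_pos Torus.continuous_geometry_translate hij hc).le
  have hquad : |⟪(A (γ t i).1 + A (γ t j).1) n, n⟫_ℝ| ≤ (C + C) * ‖n‖ ^ 2 := by
    refine (abs_real_inner_le_norm _ _).trans ?_
    rw [pow_two, ← mul_assoc]
    refine mul_le_mul_of_nonneg_right ((ContinuousLinearMap.le_opNorm _ _).trans
      (mul_le_mul_of_nonneg_right ((norm_add_le _ _).trans (add_le_add (hC _) (hC _)))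
        (norm_nonneg _))) (norm_nonneg _)
  by_cases hn : n = 0
  · have hq0 : q = 0 := by rw [hq_def, hn, inner_zero_left]
    simp [hn, hq0]
  · have hn2 : 0 < ‖n‖ ^ 2 := by positivity
    rw [abs_mul, abs_mul, abs_of_nonneg (by norm_num : (0 : ℝ) ≤ 2⁻¹), abs_div, abs_of_nonneg hq,
      abs_of_nonneg hn2.le]
    have e : q / ‖n‖ ^ 2 * ((C + C) * ‖n‖ ^ 2) = C * ((1 + 1) * q) := by
      field_simp
    calc 2⁻¹ * (q / ‖n‖ ^ 2 * |⟪(A (γ t i).1 + A (γ t j).1) n, n⟫_ℝ|)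
        ≤ 2⁻¹ * (q / ‖n‖ ^ 2 * ((C + C) * ‖n‖ ^ 2)) := by gcongr
      _ = C * (2⁻¹ * ((1 + 1) * q)) := by rw [e]; ring

/-- Per collision the scalar virial is at most `ε` times the impulse: `⟪n, Δvᵢ⟫ ≤ ‖n‖ ‖Δvᵢ‖ = ε ‖Δvᵢ‖`,
so `Σ_{(i,j)} virialKernel 1 ≤ ε · ½ Σ_{(i,j)} ‖Δv‖` (`ε < 1/2`). [folklore] -/
theorem sum_collidingPairs_virialKernel_one_le (hε : ε < 2⁻¹)
    (h : IsHardSphereTrajectory (Torus.geometry d) ε N γ) {t : ℝ} {i j : Fin N} (hij : i ≠ j)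
    (hc : γ t ∈ contactSet (Torus.geometry d) N ε i j) :
    ∑ p ∈ collidingPairs (Torus.geometry d) ε (γ t),
        virialKernel (Torus.geometry d) (fun _ => (1 : ℝ)) p.1 p.2 (leftLim γ t) (γ t) ≤
      ε * (2⁻¹ * ∑ p ∈ collidingPairs (Torus.geometry d) ε (γ t),
        ‖((γ t) p.1).2 - ((leftLim γ t) p.1).2‖) := by
  have hreg := Torus.isHardSphereRegular_geometry (d := d) hε
  rw [h.sum_collidingPairs_virialKernel hreg hij hc, h.sum_collidingPairs_eq hij hc]
  have hvj : ‖(γ t j).2 - (leftLim γ t j).2‖ = ‖(γ t i).2 - (leftLim γ t i).2‖ := by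
    rw [h.vel_sub_leftLim_right_eq_neg hij hc, norm_neg]
  have hε' : ‖(Torus.geometry d).sepVec (γ t i).1 (γ t j).1‖ = ε := (mem_contactSet.1 hc).2
  rw [hvj]
  calc 2⁻¹ * ((1 + 1) * ⟪(Torus.geometry d).sepVec (γ t i).1 (γ t j).1,
          (γ t i).2 - (leftLim γ t i).2⟫_ℝ)
      ≤ 2⁻¹ * ((1 + 1) * (ε * ‖(γ t i).2 - (leftLim γ t i).2‖)) := by
        gcongr
        rw [← hε']
        exact real_inner_le_norm _ _
    _ = _ := by ring

end Collision

/-! ## Along a trajectory: domination and the isotropic/deviatoric split -/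

section Trajectory

variable {d : Type*} [Fintype d] {N : ℕ} {ε : ℝ} {γ : ℝ → Config N d (UnitAddTorus d)}

/-- **Domination of the collisional stress by the scalar virial** along a hard-sphere trajectory on
`𝕋ᵈ` (`ε < 1/2`): `|collisionalStress A (a, b]| ≤ sup‖A‖ · collisionalVirial 1 (a, b]`. [folklore] -/
theorem abs_collisionalStress_le_mul_collisionalVirial_one (hε : ε < 2⁻¹)
    (h : IsHardSphereTrajectory (Torus.geometry d) ε N γ)
    {A : UnitAddTorus d → EuclideanSpace ℝ d →L[ℝ] EuclideanSpace ℝ d} {C : ℝ} (hC : ∀ x, ‖A x‖ ≤ C)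
    (a b : ℝ) :
    |collisionalStress (Torus.geometry d) ε A γ a b| ≤
      C * collisionalVirial (Torus.geometry d) ε (fun _ => (1 : ℝ)) γ a b := by
  have hfin := h.finite_collisionTimes_inter_Ioc a b
  rw [collisionalStress, collisionalVirial, collisionalTransferFunctional_eq_sum _ hfin,
    collisionalTransferFunctional_eq_sum _ hfin, Finset.mul_sum]
  refine (Finset.abs_sum_le_sum_abs _ _).trans (Finset.sum_le_sum fun t ht => ?_)
  obtain ⟨i, j, hij, hc⟩ := mem_collisionTimes.1 (hfin.mem_toFinset.1 ht).1
  exact abs_sum_collidingPairs_stressKernel_le hε h hij hc hC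

/-- **The scalar virial is `O(ε)` times the speed-jump functional**:
`collisionalVirial 1 (a, b] ≤ ε · ½ 𝒮(a, b]` (`ε < 1/2`). [folklore] -/
theorem collisionalVirial_one_le (hε : ε < 2⁻¹) (h : IsHardSphereTrajectory (Torus.geometry d) ε N γ)
    (a b : ℝ) :
    collisionalVirial (Torus.geometry d) ε (fun _ => (1 : ℝ)) γ a b ≤
      ε * (2⁻¹ * collisionalTransferFunctional (Torus.geometry d) ε
        (fun i _ pre post => ‖(post i).2 - (pre i).2‖) γ a b) := by
  have hfin := h.finite_collisionTimes_inter_Ioc a b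
  rw [collisionalVirial, collisionalTransferFunctional_eq_sum _ hfin,
    collisionalTransferFunctional_eq_sum _ hfin, Finset.mul_sum, Finset.mul_sum]
  refine Finset.sum_le_sum fun t ht => ?_
  obtain ⟨i, j, hij, hc⟩ := mem_collisionTimes.1 (hfin.mem_toFinset.1 ht).1
  exact sum_collidingPairs_virialKernel_one_le hε h hij hc

/-- The scalar virial is at most `ε · ½ RS(a, b]`, `RS` the relative-speed functional
(`0 ≤ ε < 1/2`). [folklore] -/
theorem collisionalVirial_one_le_relSpeed (hε₀ : 0 ≤ ε) (hε : ε < 2⁻¹)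
    (h : IsHardSphereTrajectory (Torus.geometry d) ε N γ) (a b : ℝ) :
    collisionalVirial (Torus.geometry d) ε (fun _ => (1 : ℝ)) γ a b ≤
      ε * (2⁻¹ * collisionalTransferFunctional (Torus.geometry d) ε
        (fun i j pre _ => ‖(pre i).2 - (pre j).2‖) γ a b) :=
  (collisionalVirial_one_le hε h a b).trans (mul_le_mul_of_nonneg_left
    (mul_le_mul_of_nonneg_left (speedJumpFunctional_le_relSpeedFunctional h a b) (by norm_num)) hε₀)

/-- **The stress kernel is affine in the matrix field**: for any scalar field `ψ`,
`stressKernel A = virialKernel ψ + stressKernel (A − ψ • 𝟙)` pointwise. [folklore] -/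
theorem stressKernel_eq_virialKernel_add {X : Type*} (G : Geometry d X)
    (A : X → EuclideanSpace ℝ d →L[ℝ] EuclideanSpace ℝ d) (ψ : X → ℝ) :
    stressKernel (N := N) G A = virialKernel G ψ +
      stressKernel G (fun x => A x - ψ x • ContinuousLinearMap.id ℝ (EuclideanSpace ℝ d)) := by
  rw [virialKernel_eq_stressKernel]
  funext i j pre post
  simp only [Pi.add_apply, stressKernel_apply, sub_apply, smul_apply,
    ContinuousLinearMap.id_apply, inner_sub_left]
  ring

/-- **Isotropic/deviatoric split of the collisional stress** along a hard-sphere trajectory (any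
geometry): for every scalar field `ψ`,
`collisionalStress A (a, b] = collisionalVirial ψ (a, b] + collisionalStress (A − ψ • 𝟙) (a, b]`. [folklore] -/
theorem collisionalStress_eq_collisionalVirial_add {X : Type*} [TopologicalSpace X] {G : Geometry d X}
    {γ' : ℝ → Config N d X} (h : IsHardSphereTrajectory G ε N γ')
    (A : X → EuclideanSpace ℝ d →L[ℝ] EuclideanSpace ℝ d) (ψ : X → ℝ) (a b : ℝ) :
    collisionalStress G ε A γ' a b = collisionalVirial G ε ψ γ' a b +
      collisionalStress G ε (fun x => A x - ψ x • ContinuousLinearMap.id ℝ (EuclideanSpace ℝ d)) γ' a b := by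
  rw [collisionalStress, collisionalStress, collisionalVirial, stressKernel_eq_virialKernel_add G A ψ,
    h.collisionalTransferFunctional_add]

/-- **The deviatoric part of `Dφ` is traceless**: `tr (Dφ(x) − (div φ(x) / d) 𝟙) = 0` for a `C¹`
field on `𝕋ᵈ` (`d ≥ 1`; `div φ = tr Dφ`, `tr 𝟙 = d`). [folklore] -/
theorem trace_fderiv_sub_smul_id [DecidableEq d] [Nonempty d] {φ : UnitAddTorus d → EuclideanSpace ℝ d}
    (hφ : Torus.IsContDiff 1 φ) (x : UnitAddTorus d) :
    LinearMap.trace ℝ (EuclideanSpace ℝ d)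
      ((Torus.fderiv φ x : EuclideanSpace ℝ d →ₗ[ℝ] EuclideanSpace ℝ d) -
        (Torus.divergence φ x / Fintype.card d) • LinearMap.id) = 0 := by
  have hd : (Fintype.card d : ℝ) ≠ 0 := Nat.cast_ne_zero.2 Fintype.card_ne_zero
  rw [map_sub, map_smul, LinearMap.trace_id, finrank_euclideanSpace,
    ← Torus.divergence_eq_trace_fderiv hφ, smul_eq_mul, div_mul_cancel₀ _ hd, sub_self]

end Trajectory

/-! ## Along the flow and in mean -/

section Flow

variable {d : Type*} [Fintype d] {N : ℕ} {ε : ℝ} (Φ : HardSphereFlow (Torus.geometry d) ε N)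

/-- Flow version of the split on the good set: for every scalar field `ψ`,
`collisionalStress A (Φ_{t₁} z, h) = collisionalVirial ψ (Φ_{t₁} z, h) + collisionalStress (A − ψ • 𝟙) (Φ_{t₁} z, h)`.
[folklore] -/
theorem collisionalStress_flow_eq_collisionalVirial_add
    (A : UnitAddTorus d → EuclideanSpace ℝ d →L[ℝ] EuclideanSpace ℝ d) (ψ : UnitAddTorus d → ℝ)
    {z : Config N d (UnitAddTorus d)} (hz : z ∈ Φ.good) (t₁ h : ℝ) :
    Φ.collisionalStress A (Φ.flow t₁ z) h = Φ.collisionalVirial ψ (Φ.flow t₁ z) h +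
      Φ.collisionalStress (fun x => A x - ψ x • ContinuousLinearMap.id ℝ (EuclideanSpace ℝ d))
        (Φ.flow t₁ z) h :=
  collisionalStress_eq_collisionalVirial_add (Φ.isTrajectory _ (Φ.mapsTo_good t₁ hz)) A ψ 0 h

/-- Flow version of the two dominations on the good set (`0 ≤ ε < 1/2`, `‖A x‖ ≤ C`):
`|collisionalStress A (Φ_{t₁} z, h)| ≤ C · collisionalVirial 1 (Φ_{t₁} z, h) ≤ C ε ½ RS(Φ_{t₁} z, h)`. [folklore] -/
theorem abs_collisionalStress_flow_le (hε₀ : 0 ≤ ε) (hε : ε < 2⁻¹)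
    {A : UnitAddTorus d → EuclideanSpace ℝ d →L[ℝ] EuclideanSpace ℝ d} {C : ℝ} (hC : ∀ x, ‖A x‖ ≤ C)
    {z : Config N d (UnitAddTorus d)} (hz : z ∈ Φ.good) (t₁ h : ℝ) :
    |Φ.collisionalStress A (Φ.flow t₁ z) h| ≤ C * Φ.collisionalVirial (fun _ => (1 : ℝ)) (Φ.flow t₁ z) h ∧
      Φ.collisionalVirial (fun _ => (1 : ℝ)) (Φ.flow t₁ z) h ≤
        ε * (2⁻¹ * Φ.collisionalTransferFunctional
          (fun i j pre _ => ‖(pre i).2 - (pre j).2‖) (Φ.flow t₁ z) h) :=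
  ⟨abs_collisionalStress_le_mul_collisionalVirial_one hε (Φ.isTrajectory _ (Φ.mapsTo_good t₁ hz)) hC 0 h,
    collisionalVirial_one_le_relSpeed hε₀ hε (Φ.isTrajectory _ (Φ.mapsTo_good t₁ hz)) 0 h⟩

/-- **Conditional integrability of a collisional stress** (any law `μ ≪` Liouville, `0 ≤ ε < 1/2`,
`A` continuous with `‖A x‖ ≤ C`, `0 ≤ t₁ ≤ t₂`): if `RS ∘ Φ_{t₁}` over `(0, t₂ − t₁]` is `μ`-integrable
then so is `collisionalStress A ∘ Φ_{t₁}`, with `∫ |·| dμ ≤ C ε ½ ∫ RS ∘ Φ_{t₁} dμ`. [folklore] -/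
theorem integrable_collisionalStress_flow_of_integrable_relSpeed (hε₀ : 0 ≤ ε) (hε : ε < 2⁻¹)
    {A : UnitAddTorus d → EuclideanSpace ℝ d →L[ℝ] EuclideanSpace ℝ d} (hA : Continuous A) {C : ℝ}
    (hC : ∀ x, ‖A x‖ ≤ C) {t₁ t₂ : ℝ} (h₁ : 0 ≤ t₁) (h₁₂ : t₁ ≤ t₂)
    {μ : Measure (Config N d (UnitAddTorus d))} (hμ : μ ≪ liouville (Torus.geometry d) N ε)
    (hRS : Integrable (fun z => Φ.collisionalTransferFunctional
      (fun i j pre _ => ‖(pre i).2 - (pre j).2‖) (Φ.flow t₁ z) (t₂ - t₁)) μ) :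
    Integrable (fun z => Φ.collisionalStress A (Φ.flow t₁ z) (t₂ - t₁)) μ ∧
      ∫ z, |Φ.collisionalStress A (Φ.flow t₁ z) (t₂ - t₁)| ∂μ ≤
        C * ε * (2⁻¹ * ∫ z, Φ.collisionalTransferFunctional
          (fun i j pre _ => ‖(pre i).2 - (pre j).2‖) (Φ.flow t₁ z) (t₂ - t₁) ∂μ) := by
  have hC0 : 0 ≤ C := (norm_nonneg _).trans (hC 0)
  have hdom : ∀ᵐ z ∂μ, ‖Φ.collisionalStress A (Φ.flow t₁ z) (t₂ - t₁)‖ ≤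
      C * ε * (2⁻¹ * Φ.collisionalTransferFunctional
        (fun i j pre _ => ‖(pre i).2 - (pre j).2‖) (Φ.flow t₁ z) (t₂ - t₁)) := by
    filter_upwards [hμ.ae_le Φ.ae_mem_good] with z hz
    obtain ⟨h1, h2⟩ := abs_collisionalStress_flow_le Φ hε₀ hε hC hz t₁ (t₂ - t₁)
    rw [Real.norm_eq_abs]
    calc |Φ.collisionalStress A (Φ.flow t₁ z) (t₂ - t₁)|
        ≤ C * Φ.collisionalVirial (fun _ => (1 : ℝ)) (Φ.flow t₁ z) (t₂ - t₁) := h1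
      _ ≤ C * (ε * (2⁻¹ * Φ.collisionalTransferFunctional
          (fun i j pre _ => ‖(pre i).2 - (pre j).2‖) (Φ.flow t₁ z) (t₂ - t₁))) :=
        mul_le_mul_of_nonneg_left h2 hC0
      _ = _ := by ring
  have hint : Integrable (fun z => Φ.collisionalStress A (Φ.flow t₁ z) (t₂ - t₁)) μ :=
    ((hRS.const_mul 2⁻¹).const_mul (C * ε)).mono'
      (aemeasurable_collisionalStress_flow Φ hε hA h₁ h₁₂ hμ).aestronglyMeasurable hdom
  refine ⟨hint, (integral_mono_ae hint.abs ((hRS.const_mul 2⁻¹).const_mul (C * ε))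
    (hdom.mono fun z hz => by simpa only [Real.norm_eq_abs] using hz)).trans_eq ?_⟩
  rw [integral_const_mul, integral_const_mul]

end Flow

end CollisionalStressClosure

open CollisionalStressClosure in
/-- **Registered sub-goal `stub_collisionalStressVirialSplit` of stmt-AtomisticToContinuum-9256 (stub CS,
virial route, pathwise; EOS-free).** For every smooth vector field `φ` on `T³` there is `C ≥ 0` such that
for all `0 ≤ σ < 1/2`, every `N`, every hard-sphere flow `Φ` of `N + 1` spheres of diameter
`σ_N = hsDiameter σ N`, every good datum `z` and all `t₁, h`, along the orbit of the time-`t₁` point over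
`(0, h]`: (i) the collision-indexed stress of `Dφ` is the collisional virial of `div φ / 3` (PRESSURE part)
plus the collisional stress of the traceless field `Dφ − (div φ / 3) 𝟙` (DEVIATORIC part); (ii) the
deviatoric part is at most `C ×` the scalar virial `collisionalVirial 1 = Σ_coll ⟪n, Δvᵢ⟫ ≥ 0`;
(iii) the scalar virial is at most `σ_N · ½ RS`, `RS` the relative-speed collision functional. [folklore] -/
theorem stub_collisionalStressVirialSplit : ∀ (φ : Literature.MathematicalPhysics.KineticTheory.T3 → Literature.MathematicalPhysics.KineticTheory.V3), Literature.Analysis.FunctionSpaces.Torus.IsSmooth φ → ∃ C : ℝ, 0 ≤ C ∧ ∀ (σ : ℝ), 0 ≤ σ → σ < 1 / 2 → ∀ (N : ℕ) (Φ : Literature.Analysis.FluidPDE.HardSphereFlow (Literature.Analysis.FluidPDE.Torus.geometry (Fin 3)) (Literature.MathematicalPhysics.KineticTheory.hsDiameter σ N) (N + 1)) (z : Literature.Analysis.FluidPDE.Config (N + 1) (Fin 3) Literature.MathematicalPhysics.KineticTheory.T3), z ∈ Φ.good → ∀ (t₁ h : ℝ), Φ.collisionalStress (Literature.Analysis.FunctionSpaces.Torus.fderiv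 φ) (Φ.flow t₁ z) h = Φ.collisionalVirial (fun x => Literature.Analysis.FunctionSpaces.Torus.divergence φ x / 3) (Φ.flow t₁ z) h + Φ.collisionalStress (fun x => Literature.Analysis.FunctionSpaces.Torus.fderiv φ x - (Literature.Analysis.FunctionSpaces.Torus.divergence φ x / 3) • ContinuousLinearMap.id ℝ Literature.MathematicalPhysics.KineticTheory.V3) (Φ.flow t₁ z) h ∧ |Φ.collisionalStress (fun x => Literature.Analysis.FunctionSpaces.Torus.fderiv φ x - (Literature.Analysis.FunctionSpaces.Torus.divergence φ x / 3) • ContinuousLinearMap.id ℝ Literature.MathematicalPhysics.KineticTheory.V3) (Φ.flow t₁ z) h| ≤ C * Φ.collisionalVirial (fun _ => (1 : ℝ)) (Φ.flow t₁ z) h ∧ Φ.collisionalVirial (fun _ => (1 : ℝ)) (Φ.flow t₁ z) h ≤ Literature.MathematicalPhysics.KineticTheory.hsDiameter σ N * (2⁻¹ * Φ.collisionalTransferFunctional (fun (i j : Fin (N + 1)) (pre _post : Literature.Analysis.FluidPDE.Config (N + 1) (Fin 3) Literature.MathematicalPhysics.KineticTheory.T3) => ‖(pre i).2 - (pre j).2‖)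 (Φ.flow t₁ z) h) := by
  intro φ hφ
  obtain ⟨h1, -, -, -⟩ := exists_bounds_of_isSmooth hφ
  have hcont : Continuous fun x => Torus.fderiv φ x -
      (Torus.divergence φ x / 3) • ContinuousLinearMap.id ℝ V3 :=
    (Torus.continuous_fderiv h1).sub ((hφ.divergence.continuous.div_const 3).smul continuous_const)
  obtain ⟨C, hC⟩ := isCompact_univ.exists_bound_of_continuousOn hcont.continuousOn
  refine ⟨max C 0, le_max_right _ _, ?_⟩
  intro σ hσ hσ₂ N Φ z hz t₁ h
  have hε : hsDiameter σ N < 2⁻¹ :=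
    (hsDiameter_le hσ N).trans_lt (by simpa only [one_div] using hσ₂)
  have hε₀ : 0 ≤ hsDiameter σ N := mul_nonneg hσ (Real.rpow_nonneg (Nat.cast_nonneg _) _)
  have hC' : ∀ x, ‖Torus.fderiv φ x - (Torus.divergence φ x / 3) • ContinuousLinearMap.id ℝ V3‖ ≤
      max C 0 := fun x => (hC x (mem_univ _)).trans (le_max_left _ _)
  obtain ⟨hb1, hb2⟩ := abs_collisionalStress_flow_le Φ hε₀ hε hC' hz t₁ h
  exact ⟨collisionalStress_flow_eq_collisionalVirial_add Φ _ _ hz t₁ h, hb1, hb2⟩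

end Summit.AtomisticToContinuum.HydrodynamicLimit.Theorems
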